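import Summits.Ventures.Crystal3D.Theorems.StickyWulffConstantCoaxialWallLawAzimuthScheduling
import HarnessLib

/-!
# Cyclic-scheduling certificate checker, FORWARD-PRUNING variant (cheap enough for `decide +kernel`), with soundness

HONEST FRAMING. Part of the venture `Summits/Ventures/Crystal3D` (cell `crystal3d-full`), helper
`--supports` the crux `CoaxialWallLaw` (stmt-Ventures-19481, `route-Ventures-StickyWulffConstant`),
REGISTERED line `WallLedgerF`, open stub `stub_coaxialTwoSlabAdhesion`.  RUNG CREDIT ONLY; F-C1 not moved.
Pure combinatorics (companion of `…AzimuthScheduling`).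

`azSearchF tbl T cap root N`: the same depth-first search over species sequences as `azSearch`, but an inner
node is pruned only by the species cap or by the FORWARD SCHEDULING bound — the position lower bound
`p_n = max(0, max_{j<n} p_j + tbl[s_j][s_n])` (valid for `θ_n − θ_0`) exceeding the closing bound
`T − tbl[s_0][s_n]` —, and Floyd–Warshall (`azInfeasible`) runs only on COMPLETE sequences.  Same verdicts in
practice, ≈ 10³× fewer integer operations.  SOUNDNESS `azSearchF_sound` (extra hypothesis: `θ 0 ≤ θ i`).
-/

namespace Summit.Ventures.Crystal3D.Theorems

/-! ## The checker -/

/-- Forward position lower bound of a new point of species `a` after the prefix `pre` with bounds `pos`: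
`max(0, max_{j<k} pos[j] + tbl[pre[j]][a])` over the first `k` prefix points. -/
def azFwdAux (tbl : List (List ℤ)) (pre : List ℕ) (pos : List ℤ) (a : ℕ) : ℕ → ℤ
  | 0 => 0
  | j + 1 => max (azFwdAux tbl pre pos a j) (pos.getD j 0 + azGet tbl (pre.getD j 0) a)

/-- **The forward-pruning search** (`fuel` = points still to place; Floyd–Warshall only at full length). -/
def azSearchFGo (tbl : List (List ℤ)) (T : ℤ) (cap : List ℕ) : ℕ → List ℕ → List ℤ → Bool
  | 0, pre, _ => azInfeasible tbl T pre
  | fuel + 1, pre, pos => (List.range tbl.length).all fun a =>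
      decide (cap.getD a 0 ≤ pre.count a) ||
        (decide (T - azGet tbl (pre.getD 0 0) a < azFwdAux tbl pre pos a pre.length) ||
          azSearchFGo tbl T cap fuel (pre ++ [a]) (pos ++ [azFwdAux tbl pre pos a pre.length]))

/-- **The forward-pruning checker.** -/
def azSearchF (tbl : List (List ℤ)) (T : ℤ) (cap : List ℕ) (root N : ℕ) : Bool :=
  azSearchFGo tbl T cap (N - 1) [root] [0]

/-! ## Soundness -/

/-- The forward bound is a valid lower bound on `θ n − θ 0`. -/
theorem azFwdAux_le {tbl : List (List ℤ)} {T : ℤ} {s : ℕ → ℕ} {θ : ℕ → ℝ} {N n : ℕ} (hn : n < N)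
    (hsep : ∀ i j, i < j → j < N →
      ((azGet tbl (s i) (s j) : ℤ) : ℝ) ≤ θ j - θ i ∧ ((azGet tbl (s i) (s j) : ℤ) : ℝ) ≤ θ i + T - θ j)
    (hmono : θ 0 ≤ θ n) {pos : List ℤ} (hlen : pos.length = n)
    (hpos : ∀ j (hj : j < n), ((pos.getD j 0 : ℤ) : ℝ) ≤ θ j - θ 0) :
    ∀ k, k ≤ n → ((azFwdAux tbl ((List.range n).map s) pos (s n) k : ℤ) : ℝ) ≤ θ n - θ 0
  | 0, _ => by simp [azFwdAux]; linarith
  | k + 1, hk => by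
      have ih := azFwdAux_le hn hsep hmono hlen hpos k (Nat.le_of_succ_le hk)
      have hkn : k < n := Nat.lt_of_succ_le hk
      unfold azFwdAux
      rw [Int.cast_max]
      refine max_le ih ?_
      have hg : ((List.range n).map s).getD k 0 = s k := by
        rw [List.getD_eq_getElem _ _ (by simpa using hkn), List.getElem_map, List.getElem_range]
      rw [hg]
      push_cast
      have h1 := hpos k hkn
      have h2 := (hsep k n hkn hn).1
      linarith

/-- **Soundness of the forward-pruning search.** -/
theorem azSearchFGo_sound {tbl : List (List ℤ)} {T : ℤ} {cap : List ℕ} {s : ℕ → ℕ} {θ : ℕ → ℝ} {N : ℕ}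
    (hsS : ∀ i < N, s i < tbl.length)
    (hsep : ∀ i j, i < j → j < N →
      ((azGet tbl (s i) (s j) : ℤ) : ℝ) ≤ θ j - θ i ∧ ((azGet tbl (s i) (s j) : ℤ) : ℝ) ≤ θ i + T - θ j)
    (hmono : ∀ i < N, θ 0 ≤ θ i)
    (hcap : ∀ a, ((List.range N).map s).count a ≤ cap.getD a 0) :
    ∀ fuel n (pos : List ℤ), n + fuel = N → 1 ≤ n → pos.length = n →
      (∀ j (hj : j < n), ((pos.getD j 0 : ℤ) : ℝ) ≤ θ j - θ 0) →
      azSearchFGo tbl T cap fuel ((List.range n).map s) pos = true → False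
  | 0, n, pos, hn, _, _, _, h => by
      unfold azSearchFGo at h
      have hv := azValid_base (tbl := tbl) (T := T) (s := s) (θ := θ) (n := n) (by omega) hsep
      rw [azInfeasible_false_of_valid hv] at h
      exact Bool.false_ne_true h
  | fuel + 1, n, pos, hn, h1n, hlen, hpos, h => by
      unfold azSearchFGo at h
      rw [List.all_eq_true] at h
      have hnN : n < N := by omega
      have ha := h (s n) (List.mem_range.2 (hsS n hnN))
      simp only [Bool.or_eq_true, decide_eq_true_eq] at ha
      have hpre : (List.range n).map s ++ [s n] = (List.range (n + 1)).map s := by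
        rw [List.range_succ, List.map_append, List.map_singleton]
      have hlenmap : ((List.range n).map s).length = n := by simp
      rcases ha with hc | hcl | hrec
      · have hsub : List.Sublist ((List.range (n + 1)).map s) ((List.range N).map s) :=
          (List.range_sublist.2 (by omega)).map s
        have h1 : ((List.range (n + 1)).map s).count (s n) ≤ ((List.range N).map s).count (s n) :=
          hsub.count_le _
        have h2 : ((List.range (n + 1)).map s).count (s n) = ((List.range n).map s).count (s n) + 1 := by
          rw [← hpre, List.count_append, List.count_singleton_self]
        have h3 := hcap (s n)
        omega
      · -- the closing prune fired: impossible
        rw [hlenmap] at hcl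
        have hf := azFwdAux_le (tbl := tbl) (T := T) hnN hsep (hmono n hnN) hlen hpos n le_rfl
        have hg0 : ((List.range n).map s).getD 0 0 = s 0 := by
          rw [List.getD_eq_getElem _ _ (by simp; omega), List.getElem_map, List.getElem_range]
        rw [hg0] at hcl
        have h0n := (hsep 0 n (by omega) hnN).2
        have : ((T - azGet tbl (s 0) (s n) : ℤ) : ℝ) <
            ((azFwdAux tbl ((List.range n).map s) pos (s n) n : ℤ) : ℝ) := by exact_mod_cast hcl
        push_cast at this
        linarith
      · rw [hlenmap, hpre] at hrec
        refine azSearchFGo_sound hsS hsep hmono hcap fuel (n + 1) _ (by omega) (by omega)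
          (by rw [List.length_append, hlen]; simp) ?_ hrec
        intro j hj
        by_cases hjn : j < n
        · rw [List.getD_eq_getElem _ _ (by rw [List.length_append, hlen]; simp; omega),
            List.getElem_append_left (by rw [hlen]; exact hjn)]
          have := hpos j hjn
          rwa [List.getD_eq_getElem _ _ (by rw [hlen]; exact hjn)] at this
        · have hj' : j = n := by omega
          subst hj'
          rw [List.getD_eq_getElem _ _ (by rw [List.length_append, hlen]; simp),
            List.getElem_append_right (by rw [hlen])]
          simp only [hlen, Nat.sub_self, List.getElem_cons_zero]
          exact azFwdAux_le (tbl := tbl) (T := T) hnN hsep (hmono j hnN) hlen hpos j le_rfl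

/-- **SOUNDNESS OF THE FORWARD-PRUNING CHECKER.**  If `azSearchF tbl T cap root N = true` then there is no
configuration of `N` points — species `s i < #tbl`, `s 0 = root`, positions `θ` with `θ 0 ≤ θ i`, both arcs of every
pair `i < j < N` at least `tbl[s i][s j]`, and at most `cap a` points of each species `a`. -/
theorem azSearchF_sound {tbl : List (List ℤ)} {T : ℤ} {cap : List ℕ} {root N : ℕ}
    (h : azSearchF tbl T cap root N = true) (hN : 1 ≤ N)
    (s : ℕ → ℕ) (θ : ℕ → ℝ) (hsS : ∀ i < N, s i < tbl.length) (hs0 : s 0 = root)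
    (hmono : ∀ i < N, θ 0 ≤ θ i)
    (hsep : ∀ i j, i < j → j < N →
      ((azGet tbl (s i) (s j) : ℤ) : ℝ) ≤ θ j - θ i ∧ ((azGet tbl (s i) (s j) : ℤ) : ℝ) ≤ θ i + T - θ j)
    (hcap : ∀ a, ((List.range N).map s).count a ≤ cap.getD a 0) : False := by
  unfold azSearchF at h
  have hpre : [root] = (List.range 1).map s := by
    rw [List.range_one, List.map_singleton, hs0]
  rw [hpre] at h
  refine azSearchFGo_sound hsS hsep hmono hcap (N - 1) 1 [0] (by omega) le_rfl rfl ?_ h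
  intro j hj
  have : j = 0 := by omega
  subst this
  simp

end Summit.Ventures.Crystal3D.Theorems
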